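import Summits.BirchSwinnertonDyer.Rank1Residual.Additive.QuadraticBranchMinusLFunctionExistence
import Summits.BirchSwinnertonDyer.Rank1Residual.Additive.QuadraticBranchMinusLFunctionUnique
import Summits.BirchSwinnertonDyer.BirchSwinnertonDyer.Theorems.ThetaPartnerAtTwoSignedKatoUpToAtTwoColemanMazurTateGlue
import HarnessLib

/-!
# Route `QuadraticBranchSignedControl` (rung K8, cell `bsd-potss`), residual crux `PlusEtaMainConjectureNonsurj`
# (stmt-BirchSwinnertonDyer-19606): THE θ-COEFFICIENT CONGRUENCE — the first Taylor coefficient of Kobayashi's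
# `L_p⁻(V, η, X)` READ OFF THE MODULAR SYMBOLS of the Mazur–Tate element `θ_{2m+1}(η)` modulo `p^{2m+1}`
# (seat `bsd-potss-k8eta-c2` g24; kernel tool behind the numerical hypothesis (N1′) of the rank-one `BSD_p` records)

WHY. Every rank-one `BSD_p` record of this crux (g22 `…ConjADoorBSDRankOneCoeff`, g22/g23 record files) displays the
hypothesis (N1′) «for every period-normalised minus branch function `L = L_p⁻(V, η, X)`
(`IsQuadraticBranchMinusLFunction f p ϖ L`), `coeff₁ L ≠ 0` and `v_p(coeff₁ L) = k`» — a statement about an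
element of `Λ = ℤ_p⟦X⟧` pinned only by infinitely many interpolation values, which the seats MEASURED (g22: `±`
`p`-adic `L`-series; g23: engine MT-C1) but which no finite datum displayed in the tree determines. THIS FILE proves
that `coeff₁ L` modulo `p^{m+1}` IS a finite datum: the `X`-coefficient of the tree's quadratic-branch Mazur–Tate
element `θ_{2m+1}(η) = quadraticBranchMazurTateElement p f (2m+1) ∈ ℚ[X]` — a signed sum of `p^{2m+1}(p−1)`
modular symbols `[a/p^{2m+2}]^δ_f` — through the congruence
`p^m · coeff₁ L = (−1)^{m+1} · v · ϖ · coeff₁ θ_{2m+1}(η) + p^{2m+1} · ϖ · r`, `v ∈ ℤ_pˣ`, `r ∈ ℤ_p`.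
Hence `v_p(coeff₁ L) = v_p(ϖ · coeff₁ θ_{2m+1}(η)) − m` as soon as the right-hand side is read below `m + 1`
(level `1`: `coeff₁ L ∈ ℤ_pˣ ⟺ p ∤ ϖ·coeff₁ θ₁(η)`; level `3`: `v_p(coeff₁ L) = 1 ⟺ v_p(ϖ·coeff₁ θ₃(η)) = 2`), and
the records' (N1′) becomes a displayed statement about EXACT RATIONAL modular symbols (the quantity g23's engine
computes in its stage 2), no `p`-adic `L`-function in sight.

MATHEMATICS (pure `Λ`-algebra over the tree's own construction; no analysis added). bsd-potss-ctrl built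
`M ∈ Λ` with `θ_{2m+1}(η) ≡ (−1)^{m+1} ω⁺_{2m+1} M (mod ω_{2m+1})` for every `m`
(`exists_isCongrModOmega_quadraticBranch_odd`; the tree's `IsCongrModOmega` allows a power of `p` on the left, which
§1 removes with the tree's `p`-saturation `SignedKatoOffTwo.CoreFin.exists_eq_omega_mul_of_C_pow_mul_eq` — `ω_n ∉ (p)` —
and the integrality `θ_n(η) ∈ ℤ_p[X]`, `exists_map_eq_map_quadraticBranchMazurTateElement`). Comparing the
coefficients of `X` in `θ_n(η) − (−1)^{m+1} ω⁺_n M = ω_n q` (`n = 2m+1`): `ω⁺_n(0) = ∏_{k ≤ m} Φ_{p^{2k}}(1) = p^m`,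
`M(0) = 0`, `ω_n(0) = 0`, `coeff₁ ω_n = p^n`, so `coeff₁ θ_n(η) = (−1)^{m+1} p^m coeff₁ M + p^n q(0)` (§1). The same
congruences make `M` a solution of Kobayashi's interpolation property with `ϖ = 1` (§2, the tree's existence proof
unbundled), so every `L` with `IsQuadraticBranchMinusLFunction f p ϖ L`, `‖ϖ‖_p ≤ 1`, is `v · ϖ · M` for a unit `v`
(x1b's uniqueness `IsQuadraticBranchMinusLFunction.exists_units_smul_eq`) and `coeff₁ L = v ϖ coeff₁ M` (§2); §3 is
the displayed congruence and §4 its valuation readings.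

WHAT (this file = §0–§2; the congruence for every `L`, its valuation readings and the record-facing hypotheses are the
sequel `…MinusCoeffCongruenceReadings.lean`). §0 `coeff_one_cyclotomicOmega`, `coeff_zero_cyclotomicOmegaPlus_two_mul_add_one`,
`coeff_one_mul`; §1 `exists_sub_eq_omega_mul_of_isCongrModOmega`
(integral congruence), `exists_coeff_one_mazurTate_eq` (coefficient identity for `M`); §2
`isQuadraticBranchMinusLFunction_one_of_isCongrModOmega` (the Mazur–Tate limit is a branch function, `ϖ = 1`),
`isQuadraticBranchMinusLFunction_C_mul` (scaling), `exists_units_coeff_one_eq` (`coeff₁ L = v·ϖ·coeff₁ M`).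

HONEST FRAMING (cell `bsd-potss`; FULL-BSD rank ≤ 1 programme, HUMAN RULING D-0036/D-0074): TOOL THEOREMS ONLY — no
definition, no named fact, no `sorry`, axioms standard; nothing about (A), (C1⁺_η), C-cc-1 or `BSD(W,p)` of any pair
is claimed; no stub of 19606 is proved; crux and route OPEN; nothing booked. `--supports stmt-BirchSwinnertonDyer-19606`.

References: [Kobayashi2003] Thm. 3.2, (3.5), (3.7) (p. 7); [Pollack2003] Prop. 6.18, §6.5; [MazurTateTeitelbaum1986Invent]
§I.13; [Washington1997] §7.1. Tree: `Additive/QuadraticBranch{MazurTateElement,MazurTateThreeTerm,MazurTateLimit,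
MinusLFunctionExistence,MinusLFunctionUnique,CharacterEvaluation}.lean` (bsd-potss-ctrl, x1b),
`Literature/…/PlusMinusPAdicLFunction.lean` (`IsCongrModOmega`, `cyclotomicOmega±`), the `p`-saturation of `ω_n Λ`
`Theorems/ThetaPartnerAtTwoSignedKatoUpToAtTwoColemanMazurTateGlue.lean` (bsd-wall, reused by import).
-/

set_option autoImplicit false
set_option linter.dupNamespace false
noncomputable section

open scoped Classical MatrixGroups ModularForm

open CongruenceSubgroup Polynomial Literature.NumberTheory.EllipticCurves
  Literature.NumberTheory.EllipticCurves.ModularForms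
open Summit.BirchSwinnertonDyer.Rank1Residual.Additive

namespace Summit.BirchSwinnertonDyer.BirchSwinnertonDyer.Theorems.EtaMinusCoeffCongruence

variable {p : ℕ} [hp : Fact p.Prime]

/-! ## §0 Coefficients of `ω_n` and `ω⁺_{2m+1}` -/

omit hp in
/-- `ω_n(0) = 0` (`ω_n = (1+X)^{pⁿ} − 1`). [cite: Pollack2003, §6.5 (display before Prop. 6.18)] -/
theorem coeff_zero_cyclotomicOmega (n : ℕ) : (cyclotomicOmega p n).coeff 0 = 0 := by
  rw [cyclotomicOmega, coeff_sub, coeff_X_add_one_pow, coeff_one]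
  simp

omit hp in
/-- `coeff₁ ω_n = pⁿ` (`ω_n = (1+X)^{pⁿ} − 1`). [cite: Pollack2003, §6.5 (display before Prop. 6.18)] -/
theorem coeff_one_cyclotomicOmega (n : ℕ) : (cyclotomicOmega p n).coeff 1 = (p : ℤ) ^ n := by
  rw [cyclotomicOmega, coeff_sub, coeff_X_add_one_pow, coeff_one]
  simp

/-- `ω⁺_{2m+1}(0) = p^m`: `ω⁺_{2m+1} = ω⁺_{2m} = ∏_{i<m} Φ_{p^{2i+2}}(1+X)` and `Φ_{p^k}(1) = p` (`k ≥ 1`).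
[cite: Pollack2003, §6.5 (display before Prop. 6.18)] -/
theorem coeff_zero_cyclotomicOmegaPlus_two_mul_add_one (m : ℕ) :
    (cyclotomicOmegaPlus p (2 * m + 1)).coeff 0 = (p : ℤ) ^ m := by
  rw [cyclotomicOmegaPlus_two_mul_add_one, cyclotomicOmegaPlus_two_mul_eq_prod, coeff_zero_eq_eval_zero,
    eval_prod]
  have h : ∀ i ∈ Finset.range m, eval 0 ((cyclotomic (p ^ (2 * i + 2)) ℤ).comp (X + 1)) = (p : ℤ) := by
    intro i _
    rw [eval_comp, eval_add, eval_X, eval_one, zero_add, show 2 * i + 2 = (2 * i + 1) + 1 from rfl,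
      eval_one_cyclotomic_prime_pow]
  rw [Finset.prod_congr rfl h, Finset.prod_const, Finset.card_range]

omit hp in
/-- `coeff₁ (A·B) = A(0)·coeff₁ B + coeff₁ A · B(0)` for power series. [folklore] -/
theorem coeff_one_mul {R : Type*} [CommSemiring R] (A B : PowerSeries R) :
    PowerSeries.coeff 1 (A * B) =
      PowerSeries.coeff 0 A * PowerSeries.coeff 1 B + PowerSeries.coeff 1 A * PowerSeries.coeff 0 B := by
  rw [PowerSeries.coeff_mul, Finset.Nat.antidiagonal_succ]
  simp

/-! ## §1 The integral congruence and the coefficient of `X` of the Mazur–Tate limit `M` -/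

section MazurTate

variable {N : ℕ} [NeZero N] {f : CuspForm (Gamma0 N) 2}

/-- **The congruence `θ_n(η) ≡ ω · M (mod ω_n)` holds IN `Λ`** (no `p` inverted): if
`IsCongrModOmega p n (θ_n(η)) ω M` then, for an integral lift `Θ ∈ ℤ_p[X]` of `θ_n(η)` (which exists:
`exists_map_eq_map_quadraticBranchMazurTateElement`), `Θ − ω·M = ω_n · q` with `q ∈ Λ` (pull the identity
`p^k(θ − ωM) = ω_n q` back along `Λ ↪ ℚ_p⟦X⟧` and remove `p^k`: `ω_n ∉ (p)`). [cite: Pollack2003, Prop. 6.18] -/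
theorem exists_sub_eq_omega_mul_of_isCongrModOmega (hp2 : p ≠ 2) (hf0 : IsNewform0 f)
    (hQ : coeffField f = ⊥) (hpN : ¬ p ∣ N) (hap : cuspCoeff f p = ((0 : ℤ) : ℂ)) {n : ℕ} {ω : ℤ[X]}
    {M : IwasawaAlgebra p} (hM : IsCongrModOmega p n (quadraticBranchMazurTateElement p f n) ω M) :
    ∃ (Θ : ℤ_[p][X]) (q : IwasawaAlgebra p),
      Θ.map (algebraMap ℤ_[p] ℚ_[p]) = (quadraticBranchMazurTateElement p f n).map (algebraMap ℚ ℚ_[p]) ∧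
      (Θ : PowerSeries ℤ_[p]) - ((ω.map (Int.castRingHom ℤ_[p]) : ℤ_[p][X]) : PowerSeries ℤ_[p]) * M =
        ((cyclotomicOmega p n).map (Int.castRingHom ℤ_[p]) : PowerSeries ℤ_[p]) * q := by
  obtain ⟨Θ, hΘ⟩ := exists_map_eq_map_quadraticBranchMazurTateElement hp2 hf0 hQ hpN hap n
  obtain ⟨k, q, hkq⟩ := hM
  have hθ : (((quadraticBranchMazurTateElement p f n).map (algebraMap ℚ ℚ_[p]) : ℚ_[p][X]) :
      PowerSeries ℚ_[p]) = iwasawaToPowerSeries p (Θ : PowerSeries ℤ_[p]) := by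
    rw [← hΘ, Polynomial.polynomial_map_coe]
  have hC : iwasawaToPowerSeries p (PowerSeries.C ((p : ℤ_[p]) ^ k)) = PowerSeries.C ((p : ℚ_[p]) ^ k) := by
    rw [iwasawaToPowerSeries, PowerSeries.map_C, map_pow, map_natCast]
  have key : iwasawaToPowerSeries p (PowerSeries.C ((p : ℤ_[p]) ^ k) *
      ((Θ : PowerSeries ℤ_[p]) - ((ω.map (Int.castRingHom ℤ_[p]) : ℤ_[p][X]) : PowerSeries ℤ_[p]) * M)) =
      iwasawaToPowerSeries p (((cyclotomicOmega p n).map (Int.castRingHom ℤ_[p]) : PowerSeries ℤ_[p]) * q) := by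
    rw [map_mul, map_sub, hC, ← hθ, ← hkq]
  obtain ⟨q', hq'⟩ := SignedKatoOffTwo.CoreFin.exists_eq_omega_mul_of_C_pow_mul_eq n k
    (iwasawaToPowerSeries_injective p key)
  exact ⟨Θ, q', hΘ, hq'⟩

/-- **The `X`-coefficient of the Mazur–Tate limit, read off `θ_{2m+1}(η)`**: if `M ∈ Λ`, `M(0) = 0`, satisfies
`θ_{2m+1}(η) ≡ (−1)^{m+1} ω⁺_{2m+1} M (mod ω_{2m+1})`, then
`coeff₁ θ_{2m+1}(η) = (−1)^{m+1} p^m coeff₁ M + p^{2m+1} r` for some `r ∈ ℤ_p` (in `ℚ_p`; `coeff₁ θ_{2m+1}(η) ∈ ℚ`):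
compare the coefficients of `X` using `ω⁺_{2m+1}(0) = p^m`, `ω_{2m+1}(0) = 0`, `coeff₁ ω_{2m+1} = p^{2m+1}`.
[cite: Pollack2003, Prop. 6.18] [cite: MazurTateTeitelbaum1986Invent, §I.13] -/
theorem exists_coeff_one_mazurTate_eq (hp2 : p ≠ 2) (hf0 : IsNewform0 f)
    (hQ : coeffField f = ⊥) (hpN : ¬ p ∣ N) (hap : cuspCoeff f p = ((0 : ℤ) : ℂ)) (m : ℕ)
    {M : IwasawaAlgebra p} (hM0 : PowerSeries.constantCoeff M = 0)
    (hM : IsCongrModOmega p (2 * m + 1) (quadraticBranchMazurTateElement p f (2 * m + 1))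
      ((-1) ^ (m + 1) * cyclotomicOmegaPlus p (2 * m + 1)) M) :
    ∃ r : ℤ_[p], (((quadraticBranchMazurTateElement p f (2 * m + 1)).coeff 1 : ℚ) : ℚ_[p]) =
      (-1) ^ (m + 1) * (p : ℚ_[p]) ^ m * ((PowerSeries.coeff 1 M : ℤ_[p]) : ℚ_[p]) +
        (p : ℚ_[p]) ^ (2 * m + 1) * (r : ℚ_[p]) := by
  obtain ⟨Θ, q, hΘ, hid⟩ := exists_sub_eq_omega_mul_of_isCongrModOmega hp2 hf0 hQ hpN hap hM
  refine ⟨PowerSeries.constantCoeff q, ?_⟩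
  -- the constant and linear coefficients of the three polynomials
  have hω0 : (((-1) ^ (m + 1) * cyclotomicOmegaPlus p (2 * m + 1)).map (Int.castRingHom ℤ_[p])).coeff 0 =
      (-1) ^ (m + 1) * (p : ℤ_[p]) ^ m := by
    rw [Polynomial.coeff_map, coeff_zero_eq_eval_zero, eval_mul, eval_pow, eval_neg, eval_one,
      ← coeff_zero_eq_eval_zero, coeff_zero_cyclotomicOmegaPlus_two_mul_add_one]
    simp
  have hΩ0 : ((cyclotomicOmega p (2 * m + 1)).map (Int.castRingHom ℤ_[p])).coeff 0 = 0 := by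
    rw [Polynomial.coeff_map, coeff_zero_cyclotomicOmega, map_zero]
  have hΩ1 : ((cyclotomicOmega p (2 * m + 1)).map (Int.castRingHom ℤ_[p])).coeff 1 = (p : ℤ_[p]) ^ (2 * m + 1) := by
    rw [Polynomial.coeff_map, coeff_one_cyclotomicOmega]
    simp
  have hM0' : PowerSeries.coeff 0 M = 0 := by rw [PowerSeries.coeff_zero_eq_constantCoeff, hM0]
  -- compare the coefficients of `X`
  have h1 := congrArg (PowerSeries.coeff 1) hid
  rw [map_sub, coeff_one_mul, coeff_one_mul] at h1
  simp only [Polynomial.coeff_coe] at h1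
  rw [hω0, hΩ0, hΩ1, hM0', mul_zero, add_zero, zero_mul, zero_add, PowerSeries.coeff_zero_eq_constantCoeff] at h1
  have hΘ1 : Θ.coeff 1 = (-1) ^ (m + 1) * (p : ℤ_[p]) ^ m * PowerSeries.coeff 1 M +
      (p : ℤ_[p]) ^ (2 * m + 1) * PowerSeries.constantCoeff q := by
    linear_combination h1
  -- `coeff₁ Θ = coeff₁ θ_{2m+1}(η)` in `ℚ_p`
  have hc := congrArg (fun P : ℚ_[p][X] ↦ P.coeff 1) hΘ
  simp only [Polynomial.coeff_map, eq_ratCast] at hc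
  rw [← hc, PadicInt.algebraMap_apply, hΘ1]
  push_cast
  ring

end MazurTate

/-! ## §2 From the Mazur–Tate limit `M` to every `L_p⁻(V, η, X)` -/

section Transfer

variable {N : ℕ} [NeZero N] {f : CuspForm (Gamma0 N) 2}

/-- The series `∑ ι(l_k) 0^k` sums to `ι(l_0)`. [folklore] -/
private theorem tsum_coeff_mul_zero_pow' (L : IwasawaAlgebra p) :
    ∑' k, ((algebraMap ℚ_[p] ℂ_[p]).comp (algebraMap ℤ_[p] ℚ_[p])) (PowerSeries.coeff k L) *
      (0 : ℂ_[p]) ^ k =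
      ((algebraMap ℚ_[p] ℂ_[p]).comp (algebraMap ℤ_[p] ℚ_[p])) (PowerSeries.constantCoeff L) := by
  rw [tsum_eq_single 0]
  · simp
  · intro k hk
    simp [zero_pow hk]

/-- **The Mazur–Tate limit IS a minus branch function with period ratio `1`** (the tree's existence proof
`exists_quadraticBranchMinus_mazurTate` / `exists_isQuadraticBranchMinusLFunction`, UNBUNDLED so that the congruences
and the interpolation property are available for the SAME `M`): if `M ∈ Λ` satisfies
`θ_{2m+1}(η) ≡ (−1)^{m+1} ω⁺_{2m+1} M (mod ω_{2m+1})` for every `m`, then `M(0) = 0` (level `1` at `X = 0`,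
`θ₁(η)(0) = 0`) and `M` has Kobayashi's interpolation property (3.5) with `u = 1`, `ϖ = 1` (evaluate the congruence at
`ζ − 1`, `ζ = ψ(γ)` of order `p^{2m+1}`, where `ω_{2m+1}` vanishes and `θ_{2m+1}(η)` takes the value
`∑_a ψ(a)[a/p^{2m+2}]^δ_f`). [cite: Kobayashi2003, Thm. 3.2, (3.5) and (3.7) (p. 7)] [cite: Pollack2003, Prop. 6.18] -/
theorem isQuadraticBranchMinusLFunction_one_of_isCongrModOmega (hp2 : p ≠ 2) (hf0 : IsNewform0 f)
    (hQ : coeffField f = ⊥) (hpN : ¬ p ∣ N) (hap : cuspCoeff f p = ((0 : ℤ) : ℂ)) {M : IwasawaAlgebra p}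
    (hM : ∀ m : ℕ, IsCongrModOmega p (2 * m + 1) (quadraticBranchMazurTateElement p f (2 * m + 1))
      ((-1) ^ (m + 1) * cyclotomicOmegaPlus p (2 * m + 1)) M) :
    IsQuadraticBranchMinusLFunction f p 1 M := by
  have he : cyclotomicExponent p = 1 := if_neg hp2
  set ι : ℤ_[p] →+* ℂ_[p] := (algebraMap ℚ_[p] ℂ_[p]).comp (algebraMap ℤ_[p] ℚ_[p]) with hι
  -- `M(0) = 0` from the congruence at level `1` evaluated at `X = 0` and `θ_1(η)(0) = 0`
  have hM0 : PowerSeries.constantCoeff M = 0 := by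
    have hω1 : cyclotomicOmegaPlus p (2 * 0 + 1) = 1 := by
      rw [cyclotomicOmegaPlus_two_mul_add_one, mul_zero, cyclotomicOmegaPlus_zero]
    have h0 := (hM 0).eval₂_eq (z := 0) (by simp) (by simp)
    rw [eval₂_at_zero, coeff_zero_eq_eval_zero, eval₂_mul, eval₂_pow, eval₂_neg, eval₂_one, hω1,
      eval₂_one, tsum_coeff_mul_zero_pow', mul_zero, zero_add,
      eval_zero_quadraticBranchMazurTateElement_one f hp2 hf0 hQ hpN hap, map_zero] at h0
    have h1 : ι (PowerSeries.constantCoeff M) = 0 := by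
      have : (-1 : ℂ_[p]) ^ 1 * 1 ≠ 0 := by norm_num
      rw [hι]
      exact (mul_eq_zero.mp h0.symm).resolve_left this
    exact (map_eq_zero_iff ι ((algebraMap ℚ_[p] ℂ_[p]).injective.comp
      (IsFractionRing.injective ℤ_[p] ℚ_[p]))).mp h1
  refine ⟨hM0, 1, fun n hn ψ hψ ↦ ?_⟩
  -- the interpolation property at the tree's level `n + e₀ = n + 1`
  have key : ∀ (K : ℕ) (hK : K = n + cyclotomicExponent p)
      (ψ : DirichletCharacter ℂ_[p] (p ^ K)), orderOf ψ = 2 * p ^ n →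
      HasSum (fun k : ℕ ↦ ι (PowerSeries.coeff k M) * (ψ (cyclotomicGenerator p : ZMod (p ^ K)) - 1) ^ k)
        ((-1 : ℂ_[p]) ^ ((n + 1) / 2) *
          (if Even (p / 2) then ratTwistedSymbolSum f ψ else ratMinusTwistedSymbolSum f ψ) /
          (cyclotomicOmegaPlus p n).eval₂ (algebraMap ℤ ℂ_[p])
            (ψ (cyclotomicGenerator p : ZMod (p ^ K)) - 1)) := by
    intro K hK ψ hψ
    subst hK
    obtain ⟨m, rfl⟩ := hn
    set ζ : ℂ_[p] := ψ (cyclotomicGenerator p : ZMod (p ^ (2 * m + 1 + cyclotomicExponent p))) with hζ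
    have hordζ := orderOf_apply_cyclotomicGenerator_of_orderOf_eq hp2 ψ hψ
    have hprim : IsPrimitiveRoot ζ (p ^ (2 * m + 1)) := hordζ ▸ IsPrimitiveRoot.orderOf ζ
    have hpow : ζ ^ p ^ (2 * m + 1) = 1 := hordζ ▸ pow_orderOf_eq_one ζ
    have hz : ‖ζ - 1‖ < 1 := norm_sub_one_lt_one_of_pow_prime_pow_eq_one hpow
    have hzn : (1 + (ζ - 1)) ^ p ^ (2 * m + 1) = 1 := by rwa [add_sub_cancel]
    have hω : (cyclotomicOmegaPlus p (2 * m + 1)).eval₂ (algebraMap ℤ ℂ_[p]) (ζ - 1) ≠ 0 :=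
      eval₂_cyclotomicOmegaPlus_ne_zero ⟨m, rfl⟩ hprim
    have h1 := (hM m).eval₂_eq hz hzn
    rw [eval₂_quadraticBranchMazurTateElement_eq f hp2 ψ hψ, eval₂_mul, eval₂_pow, eval₂_neg,
      eval₂_one] at h1
    have hsum : HasSum (fun k ↦ ι (PowerSeries.coeff k M) * (ζ - 1) ^ k)
        (∑' k, ι (PowerSeries.coeff k M) * (ζ - 1) ^ k) :=
      (summable_map_coeff_mul_pow _ (norm_algebraMap_coeff_le_one M) hz).hasSum
    have hval : ∑' k, ι (PowerSeries.coeff k M) * (ζ - 1) ^ k =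
        (-1 : ℂ_[p]) ^ ((2 * m + 1 + 1) / 2) *
          (if Even (p / 2) then ratTwistedSymbolSum f ψ else ratMinusTwistedSymbolSum f ψ) /
          (cyclotomicOmegaPlus p (2 * m + 1)).eval₂ (algebraMap ℤ ℂ_[p]) (ζ - 1) := by
      rw [show (2 * m + 1 + 1) / 2 = m + 1 by omega, eq_div_iff hω, h1, hι]
      have hs : ((-1 : ℂ_[p]) ^ (m + 1)) * (-1) ^ (m + 1) = 1 := by
        rw [← mul_pow, neg_one_mul, neg_neg, one_pow]
      linear_combination (-((cyclotomicOmegaPlus p (2 * m + 1)).eval₂ (algebraMap ℤ ℂ_[p]) (ζ - 1) *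
        ∑' k, ι (PowerSeries.coeff k M) * (ζ - 1) ^ k)) * hs
    rwa [hval] at hsum
  have hone : algebraMap ℚ_[p] ℂ_[p] ((((1 : ℤ_[p]ˣ) : ℤ_[p]) : ℚ_[p]) * ((1 : ℚ) : ℚ_[p])) = 1 := by
    rw [Units.val_one, PadicInt.coe_one, Rat.cast_one, mul_one, map_one]
  rw [hone, mul_one]
  exact key (n + 1) (by rw [he]) ψ hψ

omit [NeZero N] in
/-- **Scaling a branch function by a `p`-adic integer**: if `L` has the interpolation property with period ratio `ϖ`
and `c ∈ ℤ_p` is (the image of) the rational `r`, then `c · L` has it with period ratio `r · ϖ` (same unit `u`).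
[cite: Kobayashi2003, Thm. 3.2 and (3.5) (p. 7)] -/
theorem isQuadraticBranchMinusLFunction_C_mul {ϖ : ℚ} {L : IwasawaAlgebra p}
    (hL : IsQuadraticBranchMinusLFunction f p ϖ L) (c : ℤ_[p]) (r : ℚ)
    (hc : ((c : ℤ_[p]) : ℚ_[p]) = (r : ℚ_[p])) :
    IsQuadraticBranchMinusLFunction f p (r * ϖ) (PowerSeries.C c * L) := by
  obtain ⟨h0, u, H⟩ := hL
  refine ⟨by rw [map_mul, h0, mul_zero], u, fun n hn ψ hψ ↦ ?_⟩
  have h := (H n hn ψ hψ).mul_left (algebraMap ℚ_[p] ℂ_[p] (r : ℚ_[p]))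
  have hιc : ((algebraMap ℚ_[p] ℂ_[p]).comp (algebraMap ℤ_[p] ℚ_[p])) c =
      algebraMap ℚ_[p] ℂ_[p] (r : ℚ_[p]) := by
    rw [RingHom.comp_apply, PadicInt.algebraMap_apply, hc]
  have hfun : (fun k : ℕ ↦ ((algebraMap ℚ_[p] ℂ_[p]).comp (algebraMap ℤ_[p] ℚ_[p]))
        (PowerSeries.coeff k (PowerSeries.C c * L)) *
      (ψ (cyclotomicGenerator p : ZMod (p ^ (n + 1))) - 1) ^ k) =
      fun k ↦ algebraMap ℚ_[p] ℂ_[p] (r : ℚ_[p]) *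
        (((algebraMap ℚ_[p] ℂ_[p]).comp (algebraMap ℤ_[p] ℚ_[p])) (PowerSeries.coeff k L) *
          (ψ (cyclotomicGenerator p : ZMod (p ^ (n + 1))) - 1) ^ k) := by
    funext k
    rw [PowerSeries.coeff_C_mul, map_mul, hιc, mul_assoc]
  have hvalue : (-1 : ℂ_[p]) ^ ((n + 1) / 2) *
        algebraMap ℚ_[p] ℂ_[p] (((u : ℤ_[p]) : ℚ_[p]) * (((r * ϖ : ℚ)) : ℚ_[p])) *
        (if Even (p / 2) then ratTwistedSymbolSum f ψ else ratMinusTwistedSymbolSum f ψ) /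
        (cyclotomicOmegaPlus p n).eval₂ (algebraMap ℤ ℂ_[p])
          (ψ (cyclotomicGenerator p : ZMod (p ^ (n + 1))) - 1) =
      algebraMap ℚ_[p] ℂ_[p] (r : ℚ_[p]) * ((-1 : ℂ_[p]) ^ ((n + 1) / 2) *
        algebraMap ℚ_[p] ℂ_[p] (((u : ℤ_[p]) : ℚ_[p]) * (ϖ : ℚ_[p])) *
        (if Even (p / 2) then ratTwistedSymbolSum f ψ else ratMinusTwistedSymbolSum f ψ) /
        (cyclotomicOmegaPlus p n).eval₂ (algebraMap ℤ ℂ_[p])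
          (ψ (cyclotomicGenerator p : ZMod (p ^ (n + 1))) - 1)) := by
    rw [Rat.cast_mul, map_mul, map_mul, map_mul]
    ring
  rw [hfun, hvalue]
  exact h

/-- **Every minus branch function is a unit multiple of `ϖ · M`**, hence `coeff₁ L = v · ϖ · coeff₁ M` with
`v ∈ ℤ_pˣ`: `ϖ · M` is a solution for the period ratio `ϖ` (`‖ϖ‖_p ≤ 1`) by §2, and two solutions differ by a unit
(x1b's `IsQuadraticBranchMinusLFunction.exists_units_smul_eq`). [cite: Kobayashi2003, Thm. 3.2 and (3.5) (p. 7)]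
[cite: Pollack2003, Prop. 6.18] -/
theorem exists_units_coeff_one_eq (hp2 : p ≠ 2) (hf0 : IsNewform0 f) (hQ : coeffField f = ⊥)
    (hpN : ¬ p ∣ N) (hap : cuspCoeff f p = ((0 : ℤ) : ℂ)) {ϖ : ℚ} (hϖ : ‖(ϖ : ℚ_[p])‖ ≤ 1)
    {L M : IwasawaAlgebra p} (hL : IsQuadraticBranchMinusLFunction f p ϖ L)
    (hM : ∀ m : ℕ, IsCongrModOmega p (2 * m + 1) (quadraticBranchMazurTateElement p f (2 * m + 1))
      ((-1) ^ (m + 1) * cyclotomicOmegaPlus p (2 * m + 1)) M) :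
    ∃ v : ℤ_[p]ˣ, ((PowerSeries.coeff 1 L : ℤ_[p]) : ℚ_[p]) =
      ((v : ℤ_[p]) : ℚ_[p]) * ((ϖ : ℚ_[p]) * ((PowerSeries.coeff 1 M : ℤ_[p]) : ℚ_[p])) := by
  set c : ℤ_[p] := ⟨(ϖ : ℚ_[p]), hϖ⟩ with hc_def
  have hcϖ : ((c : ℤ_[p]) : ℚ_[p]) = (ϖ : ℚ_[p]) := rfl
  have h1 := isQuadraticBranchMinusLFunction_one_of_isCongrModOmega hp2 hf0 hQ hpN hap hM
  have h2 := isQuadraticBranchMinusLFunction_C_mul h1 c ϖ hcϖ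
  rw [mul_one] at h2
  obtain ⟨v, hv⟩ := h2.exists_units_smul_eq hp2 hL
  refine ⟨v, ?_⟩
  rw [hv, PowerSeries.coeff_smul, PowerSeries.coeff_C_mul, smul_eq_mul, PadicInt.coe_mul, PadicInt.coe_mul, hcϖ]

end Transfer

end Summit.BirchSwinnertonDyer.BirchSwinnertonDyer.Theorems.EtaMinusCoeffCongruence

end
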